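import Mathlib
import Summits.Ventures.PercRepro2.Defs
import Summits.Ventures.PercRepro2.Graph
import Summits.Ventures.PercRepro2.Harris
import Summits.Ventures.PercRepro2.Events
import Summits.Ventures.PercRepro2.BHKPair
import Summits.Ventures.PercRepro2.RowC1PendZCells

/-!
# Instance (I4) of the certificate of `zpp ≥ 0`: BHK 1.5 for `b ∈ C(a₂)` against `o ∉ C(v)` (blind cell PercRepro2, p2 g36)

The heaviest instance of proofs/P2-G36-CERT-ZPP.md: given `a₂ ↮ v`, the increasing function `1[b ∈ C(a₂)]` of
the cluster of `a₂` and the decreasing function `1[o ∉ C(v)]` of the cluster of `v` are positively correlated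
(`bhk_pair`, BHK06 Thm 1.5):

  `P(a₂↮v, a₂↔b) · P(a₂↮v, v↮o) ≤ P(a₂↮v, a₂↔b, v↮o) · P(a₂↮v)`,

written on the fifteen pattern cells exactly as `zpp_cert_alg` / `zpp_nonneg_of_bhk` want it (`inst4_cells`).
The template for the other ten BHK instances (P2-G36-SYM.md §7).  Std axioms.
-/

namespace Summit.Ventures.PercRepro2

namespace RowC1

section Inst4

variable {V : Type*} {E : Type*} [Fintype E] [DecidableEq E] [Fintype V] [DecidableEq V]
  {R : Type*} [Field R] [LinearOrder R] [IsStrictOrderedRing R]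

omit [Fintype V] [DecidableEq V] [LinearOrder R] [IsStrictOrderedRing R] in
/-- `E[1_𝓔(C_x) · 1_A] = P(C_x ∈ 𝓔, A)`. -/
lemma expect_indicator_cluster_mul (p : E → R) (ends : E → Sym2 V) (x : V) (𝓔 : Set (Set V))
    (A : Set (Config E)) :
    expect p (fun ω => 𝓔.indicator 1 (cluster ends ω x) * A.indicator 1 ω) =
      prob p (clusterInEvent ends x 𝓔 ∩ A) := by
  rw [prob_eq_expect_indicator]
  unfold expect
  refine Finset.sum_congr rfl fun ω _ => ?_
  congr 1
  rw [indicator_inter_one]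
  rfl

omit [Fintype V] [DecidableEq V] [LinearOrder R] [IsStrictOrderedRing R] in
/-- `E[1_𝓔(C_x) · 1_𝓕(C_y) · 1_A] = P(C_x ∈ 𝓔, C_y ∈ 𝓕, A)`. -/
lemma expect_indicator_cluster_cluster_mul (p : E → R) (ends : E → Sym2 V) (x y : V)
    (𝓔 𝓕 : Set (Set V)) (A : Set (Config E)) :
    expect p (fun ω => 𝓔.indicator 1 (cluster ends ω x) * 𝓕.indicator 1 (cluster ends ω y) *
        A.indicator 1 ω) =
      prob p (clusterInEvent ends x 𝓔 ∩ clusterInEvent ends y 𝓕 ∩ A) := by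
  rw [prob_eq_expect_indicator]
  unfold expect
  refine Finset.sum_congr rfl fun ω _ => ?_
  congr 1
  rw [indicator_inter_one, indicator_inter_one]
  rfl

omit [Fintype E] [DecidableEq E] [Fintype V] [DecidableEq V] in
/-- the cluster event `{b ∈ C(a₂)}` is the connection event. -/
lemma clusterIn_mem_eq (ends : E → Sym2 V) (x y : V) :
    clusterInEvent ends x {W : Set V | y ∈ W} = connEvent ends x y := by
  ext ω; simp [clusterInEvent, connEvent, mem_cluster]

omit [Fintype E] [DecidableEq E] [Fintype V] [DecidableEq V] in
/-- the cluster event `{o ∉ C(v)}` is the complement of the connection event. -/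
lemma clusterIn_notMem_eq (ends : E → Sym2 V) (x y : V) :
    clusterInEvent ends x {W : Set V | y ∉ W} = (connEvent ends x y)ᶜ := by
  ext ω; simp [clusterInEvent, connEvent, mem_cluster]

omit [Fintype V] [DecidableEq V] [LinearOrder R] [IsStrictOrderedRing R] in
/-- cell expansion of the event `BFc` (instance I4). -/
theorem cs4_BFc (p : E → R) (ends : E → Sym2 V) (v a₂ o b : V) :
    prob p ((connEvent ends a₂ b ∩ (connEvent ends a₂ v)ᶜ)) = (prob p (cell ends v a₂ o b 38) + prob p (cell ends v a₂ o b 12) + prob p (cell ends v a₂ o b 4)) := by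
  have e : ((connEvent ends a₂ b ∩ (connEvent ends a₂ v)ᶜ)) = {ω | (Nat.testBit (pattern ends v a₂ o b ω).val 2 = true ∧ (¬ Nat.testBit (pattern ends v a₂ o b ω).val 0 = true))} := by
    ext ω
    simp only [Set.mem_setOf_eq, connEvent, Set.mem_inter_iff, Set.mem_compl_iff, testBit_pattern_zero, testBit_pattern_two]
  rw [e, prob_pattern_eq_sum_trans p ends v a₂ o b (fun n => (Nat.testBit n.val 2 = true ∧ (¬ Nat.testBit n.val 0 = true)))]
  rw [show (Finset.univ.filter (fun n : Fin 64 => IsTrans6 n ∧ (Nat.testBit n.val 2 = true ∧ (¬ Nat.testBit n.val 0 = true)))) = ({38, 12, 4} : Finset (Fin 64)) by decide]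
  simp +decide only [Finset.sum_insert, Finset.mem_insert, Finset.mem_singleton, Finset.sum_singleton]
  ring

omit [Fintype V] [DecidableEq V] [LinearOrder R] [IsStrictOrderedRing R] in
/-- cell expansion of the event `WcFc` (instance I4). -/
theorem cs4_WcFc (p : E → R) (ends : E → Sym2 V) (v a₂ o b : V) :
    prob p (((connEvent ends v o)ᶜ ∩ (connEvent ends a₂ v)ᶜ)) = (prob p (cell ends v a₂ o b 38) + prob p (cell ends v a₂ o b 18) + prob p (cell ends v a₂ o b 2) + prob p (cell ends v a₂ o b 4) + prob p (cell ends v a₂ o b 16) + prob p (cell ends v a₂ o b 32) + prob p (cell ends v a₂ o b 0)) := by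
  have e : (((connEvent ends v o)ᶜ ∩ (connEvent ends a₂ v)ᶜ)) = {ω | ((¬ Nat.testBit (pattern ends v a₂ o b ω).val 3 = true) ∧ (¬ Nat.testBit (pattern ends v a₂ o b ω).val 0 = true))} := by
    ext ω
    simp only [Set.mem_setOf_eq, connEvent, Set.mem_inter_iff, Set.mem_compl_iff, testBit_pattern_zero, testBit_pattern_three]
  rw [e, prob_pattern_eq_sum_trans p ends v a₂ o b (fun n => ((¬ Nat.testBit n.val 3 = true) ∧ (¬ Nat.testBit n.val 0 = true)))]
  rw [show (Finset.univ.filter (fun n : Fin 64 => IsTrans6 n ∧ ((¬ Nat.testBit n.val 3 = true) ∧ (¬ Nat.testBit n.val 0 = true)))) = ({38, 18, 2, 4, 16, 32, 0} : Finset (Fin 64)) by decide]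
  simp +decide only [Finset.sum_insert, Finset.mem_insert, Finset.mem_singleton, Finset.sum_singleton]
  ring

omit [Fintype V] [DecidableEq V] [LinearOrder R] [IsStrictOrderedRing R] in
/-- cell expansion of the event `BWcFc` (instance I4). -/
theorem cs4_BWcFc (p : E → R) (ends : E → Sym2 V) (v a₂ o b : V) :
    prob p (((connEvent ends a₂ b ∩ (connEvent ends v o)ᶜ) ∩ (connEvent ends a₂ v)ᶜ)) = (prob p (cell ends v a₂ o b 38) + prob p (cell ends v a₂ o b 4)) := by
  have e : (((connEvent ends a₂ b ∩ (connEvent ends v o)ᶜ) ∩ (connEvent ends a₂ v)ᶜ)) = {ω | ((Nat.testBit (pattern ends v a₂ o b ω).val 2 = true ∧ (¬ Nat.testBit (pattern ends v a₂ o b ω).val 3 = true)) ∧ (¬ Nat.testBit (pattern ends v a₂ o b ω).val 0 = true))} := by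
    ext ω
    simp only [Set.mem_setOf_eq, connEvent, Set.mem_inter_iff, Set.mem_compl_iff, testBit_pattern_zero, testBit_pattern_two, testBit_pattern_three]
  rw [e, prob_pattern_eq_sum_trans p ends v a₂ o b (fun n => ((Nat.testBit n.val 2 = true ∧ (¬ Nat.testBit n.val 3 = true)) ∧ (¬ Nat.testBit n.val 0 = true)))]
  rw [show (Finset.univ.filter (fun n : Fin 64 => IsTrans6 n ∧ ((Nat.testBit n.val 2 = true ∧ (¬ Nat.testBit n.val 3 = true)) ∧ (¬ Nat.testBit n.val 0 = true)))) = ({38, 4} : Finset (Fin 64)) by decide]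
  simp +decide only [Finset.sum_insert, Finset.mem_singleton, Finset.sum_singleton]

omit [Fintype V] [DecidableEq V] [LinearOrder R] [IsStrictOrderedRing R] in
/-- cell expansion of the event `Fc` (instance I4). -/
theorem cs4_Fc (p : E → R) (ends : E → Sym2 V) (v a₂ o b : V) :
    prob p ((connEvent ends a₂ v)ᶜ) = (prob p (cell ends v a₂ o b 38) + prob p (cell ends v a₂ o b 18) + prob p (cell ends v a₂ o b 2) + prob p (cell ends v a₂ o b 12) + prob p (cell ends v a₂ o b 56) + prob p (cell ends v a₂ o b 8) + prob p (cell ends v a₂ o b 4) + prob p (cell ends v a₂ o b 16) + prob p (cell ends v a₂ o b 32) + prob p (cell ends v a₂ o b 0)) := by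
  have e : ((connEvent ends a₂ v)ᶜ) = {ω | (¬ Nat.testBit (pattern ends v a₂ o b ω).val 0 = true)} := by
    ext ω
    simp only [Set.mem_setOf_eq, connEvent, Set.mem_compl_iff, testBit_pattern_zero]
  rw [e, prob_pattern_eq_sum_trans p ends v a₂ o b (fun n => (¬ Nat.testBit n.val 0 = true))]
  rw [show (Finset.univ.filter (fun n : Fin 64 => IsTrans6 n ∧ (¬ Nat.testBit n.val 0 = true))) = ({38, 18, 2, 12, 56, 8, 4, 16, 32, 0} : Finset (Fin 64)) by decide]
  simp +decide only [Finset.sum_insert, Finset.mem_insert, Finset.mem_singleton, Finset.sum_singleton]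
  ring

set_option maxHeartbeats 0 in
/-- **instance (I4)** on the cells: `P(a₂↮v, a₂↔b) · P(a₂↮v, v↮o) ≤ P(a₂↮v, a₂↔b, v↮o) · P(a₂↮v)`. -/
theorem inst4_cells (p : E → R) (hp : IsProbVec p) (ends : E → Sym2 V) (v a₂ o b : V) :
    (prob p (cell ends v a₂ o b 38) + prob p (cell ends v a₂ o b 12) + prob p (cell ends v a₂ o b 4)) * (prob p (cell ends v a₂ o b 38) + prob p (cell ends v a₂ o b 18) + prob p (cell ends v a₂ o b 2) + prob p (cell ends v a₂ o b 4) + prob p (cell ends v a₂ o b 16) + prob p (cell ends v a₂ o b 32) + prob p (cell ends v a₂ o b 0)) ≤ (prob p (cell ends v a₂ o b 38) + prob p (cell ends v a₂ o b 4)) * (prob p (cell ends v a₂ o b 38) + prob p (cell ends v a₂ o b 18) + prob p (cell ends v a₂ o b 2) + prob p (cell ends v a₂ o b 12) + prob p (cell ends v a₂ o b 56) + prob p (cell ends v a₂ o b 8) + prob p (cell ends v a₂ o b 4) + prob p (cell ends v a₂ o b 16) + prob p (cell ends v a₂ o b 32) + prob p (cell ends v a₂ o b 0)) := by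
  classical
  have H := BHKPair.bhk_pair p hp ends a₂ v (F := fun W _ => ({W : Set V | b ∈ W}).indicator 1 W)
    (G := fun _ C => ({C : Set V | o ∉ C}).indicator 1 C)
    (by
      intro W W' C C' hW _
      simp only [Set.indicator, Set.mem_setOf_eq]
      split_ifs with h1 h2 <;> first | exact le_rfl | exact absurd (hW h1) h2 | norm_num)
    (by
      intro W W' C C' _ hC
      simp only [Set.indicator, Set.mem_setOf_eq]
      split_ifs with h1 h2 <;> first | exact le_rfl | exact absurd (hC ‹o ∈ C'›) h1 | norm_num)
    (fun W C => Set.indicator_nonneg (fun _ _ => zero_le_one) _)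
    (fun W C => Set.indicator_nonneg (fun _ _ => zero_le_one) _)
  rw [expect_indicator_cluster_mul p ends a₂ {W : Set V | b ∈ W},
    expect_indicator_cluster_mul p ends v {C : Set V | o ∉ C},
    expect_indicator_cluster_cluster_mul p ends a₂ v {W : Set V | b ∈ W} {C : Set V | o ∉ C},
    clusterIn_mem_eq, clusterIn_notMem_eq] at H
  rw [cs4_BFc p ends v a₂ o b, cs4_WcFc p ends v a₂ o b, cs4_BWcFc p ends v a₂ o b,
    cs4_Fc p ends v a₂ o b] at H
  exact H

end Inst4

end RowC1

end Summit.Ventures.PercRepro2
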